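import Summits.Ventures.Crystal3D.Theorems.StickyWulffConstantCoaxialWallLawHalfPlanarKey
import HarnessLib

/-!
# The planar-heights kissing row for offsets `τ ∈ [0.345, 0.655]`, brick 1: species, ONE certified table, the KEY inequalities

HONEST FRAMING. Part of the venture `Summits/Ventures/Crystal3D` (cell `crystal3d-full`), helper
`--supports` the crux `CoaxialWallLaw` (stmt-Ventures-19481, `route-Ventures-StickyWulffConstant`),
REGISTERED line `WallLedgerF`, open stub `stub_coaxialTwoSlabAdhesion`.  RUNG CREDIT ONLY; F-C1 not moved.

The INTERVAL version of `…HalfPlanarKey`: for EVERY offset `τ ∈ [0.345, 0.655]` the contact directions of a located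
in-plane end in a bi-planar filling come in five species `h ∈ {0, τd₀, (τ−1)d₀, d₀, −d₀}` (`mpH τ`, `d₀ = √(2/3)`), radii
`mpR τ s = √(1 − h²)`.  ONE table of certified azimuth separations `mpDelta` (`π/3, π/6, 2π/3` exact; `0.93, 1.09, 0.635,
1.055`) is valid on the whole interval: the KEY inequalities `r_s(τ) r_t(τ) cos δ(s,t) ≥ ½ − h_s(τ) h_t(τ)` hold for all
`τ ∈ [0.345, 0.655]` (`mp_key`; the binding cases are quadratic in `τ` and concave, checked at the end-points), and the
integer table `mpTbl` (units `10⁻⁴ rad`) under-estimates `10⁴ δ` (`mp_tbl`).  Numerics (seat calc/intervals.py): the table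
still refutes every 12-point pattern with `0.12°` of uniform slack.
-/

noncomputable section

namespace Summit.Ventures.Crystal3D.Theorems

open Finset Real
open scoped InnerProductSpace

/-! ## Species at offset `τ` -/

/-- Species heights at offset `τ`: `0 ↦ 0`, `1 ↦ τd₀`, `2 ↦ (τ−1)d₀`, `3 ↦ d₀`, `4 ↦ −d₀`. -/
def mpH (τ : ℝ) : ℕ → ℝ
  | 0 => 0
  | 1 => τ * Real.sqrt (2 / 3)
  | 2 => (τ - 1) * Real.sqrt (2 / 3)
  | 3 => Real.sqrt (2 / 3)
  | 4 => -Real.sqrt (2 / 3)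
  | _ => 0

/-- Horizontal radii `r_s(τ) = √(1 − h_s(τ)²)`. -/
def mpR (τ : ℝ) (s : ℕ) : ℝ := Real.sqrt (1 - mpH τ s ^ 2)

/-- Certified azimuth separations valid for every `τ ∈ [0.345, 0.655]` (radians; `0` = no constraint). -/
def mpDelta (s t : ℕ) : ℝ :=
  if s = 0 ∧ t = 0 then π / 3
  else if (s = 0 ∧ (t = 1 ∨ t = 2)) ∨ (t = 0 ∧ (s = 1 ∨ s = 2)) then 0.93
  else if (s = 0 ∧ (t = 3 ∨ t = 4)) ∨ (t = 0 ∧ (s = 3 ∨ s = 4)) then π / 6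
  else if (s = 1 ∧ t = 1) ∨ (s = 2 ∧ t = 2) then 1.09
  else if (s = 1 ∧ t = 2) ∨ (s = 2 ∧ t = 1) then 0.635
  else if (s = 1 ∧ t = 3) ∨ (s = 3 ∧ t = 1) ∨ (s = 2 ∧ t = 4) ∨ (s = 4 ∧ t = 2) then 1.055
  else if (s = 3 ∧ t = 3) ∨ (s = 4 ∧ t = 4) then 2 * π / 3
  else 0

/-- The integer table (units `10⁻⁴ rad`) fed to the checker, valid on the whole interval. -/
def mpTbl : List (List ℤ) :=
  [[10471, 9300, 9300, 5235, 5235],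
   [9300, 10900, 6350, 10550, 0],
   [9300, 6350, 10900, 0, 10550],
   [5235, 10550, 0, 20943, 0],
   [5235, 0, 10550, 0, 20943]]

/-- Species `0` height. -/
@[simp] theorem mpH_0 (τ : ℝ) : mpH τ 0 = 0 := rfl
/-- Species `1` height. -/
@[simp] theorem mpH_1 (τ : ℝ) : mpH τ 1 = τ * Real.sqrt (2 / 3) := rfl
/-- Species `2` height. -/
@[simp] theorem mpH_2 (τ : ℝ) : mpH τ 2 = (τ - 1) * Real.sqrt (2 / 3) := rfl
/-- Species `3` height. -/
@[simp] theorem mpH_3 (τ : ℝ) : mpH τ 3 = Real.sqrt (2 / 3) := rfl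
/-- Species `4` height. -/
@[simp] theorem mpH_4 (τ : ℝ) : mpH τ 4 = -Real.sqrt (2 / 3) := rfl

/-! ## Numerics -/

/-- `cos 0.93 ≥ 0.5969`. -/
theorem mp_cos_093 : (0.5969 : ℝ) ≤ Real.cos 0.93 := by
  have hπ1 := Real.pi_gt_d6
  have hπ2 := Real.pi_lt_d6
  rw [← Real.sin_pi_div_two_sub]
  have ht0 : (0 : ℝ) ≤ π / 2 - 0.93 := by linarith
  have h := Real.sin_ge_sub_cube ht0
  have hlo : (0.640796 : ℝ) ≤ π / 2 - 0.93 := by linarith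
  have hhi : π / 2 - 0.93 ≤ (0.6408 : ℝ) := by linarith
  have ht3 : (π / 2 - 0.93) ^ 3 ≤ (0.6408 : ℝ) ^ 3 := pow_le_pow_left₀ ht0 hhi 3
  norm_num at ht3
  linarith [hlo, h, ht3]

/-- `cos 1.09 ≥ 0.462`. -/
theorem mp_cos_109 : (0.462 : ℝ) ≤ Real.cos 1.09 := by
  have hπ1 := Real.pi_gt_d6
  have hπ2 := Real.pi_lt_d6
  rw [← Real.sin_pi_div_two_sub]
  have ht0 : (0 : ℝ) ≤ π / 2 - 1.09 := by linarith
  have h := Real.sin_ge_sub_cube ht0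
  have hlo : (0.480796 : ℝ) ≤ π / 2 - 1.09 := by linarith
  have hhi : π / 2 - 1.09 ≤ (0.4808 : ℝ) := by linarith
  have ht3 : (π / 2 - 1.09) ^ 3 ≤ (0.4808 : ℝ) ^ 3 := pow_le_pow_left₀ ht0 hhi 3
  norm_num at ht3
  linarith [hlo, h, ht3]

/-- `cos 1.055 ≥ 0.4929`. -/
theorem mp_cos_1055 : (0.4929 : ℝ) ≤ Real.cos 1.055 := by
  have hπ1 := Real.pi_gt_d6
  have hπ2 := Real.pi_lt_d6
  rw [← Real.sin_pi_div_two_sub]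
  have ht0 : (0 : ℝ) ≤ π / 2 - 1.055 := by linarith
  have h := Real.sin_ge_sub_cube ht0
  have hlo : (0.515796 : ℝ) ≤ π / 2 - 1.055 := by linarith
  have hhi : π / 2 - 1.055 ≤ (0.5158 : ℝ) := by linarith
  have ht3 : (π / 2 - 1.055) ^ 3 ≤ (0.5158 : ℝ) ^ 3 := pow_le_pow_left₀ ht0 hhi 3
  norm_num at ht3
  linarith [hlo, h, ht3]

/-- `cos 0.635 ≥ 0.8042` (three half-angle steps from `cos x ≥ 1 − x²/2` at `x/8`). -/
theorem mp_cos_0635 : (0.8042 : ℝ) ≤ Real.cos 0.635 := by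
  have h8 : (0.99684 : ℝ) ≤ Real.cos (0.635 / 8) := by
    have := Real.one_sub_sq_div_two_le_cos (x := (0.635 / 8 : ℝ))
    norm_num at this ⊢; linarith
  have e4 : Real.cos (0.635 / 4) = 2 * Real.cos (0.635 / 8) ^ 2 - 1 := by
    rw [← Real.cos_two_mul]; ring_nf
  have e2 : Real.cos (0.635 / 2) = 2 * Real.cos (0.635 / 4) ^ 2 - 1 := by
    rw [← Real.cos_two_mul]; ring_nf
  have e1 : Real.cos 0.635 = 2 * Real.cos (0.635 / 2) ^ 2 - 1 := by
    rw [← Real.cos_two_mul]; ring_nf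
  have h4 : (0.98737 : ℝ) ≤ Real.cos (0.635 / 4) := by
    rw [e4]; nlinarith [pow_le_pow_left₀ (by norm_num) h8 2]
  have h2 : (0.94979 : ℝ) ≤ Real.cos (0.635 / 2) := by
    rw [e2]; nlinarith [pow_le_pow_left₀ (by norm_num) h4 2]
  rw [e1]; nlinarith [pow_le_pow_left₀ (by norm_num) h2 2]

/-! ## The KEY inequalities on the interval -/

/-- KEY shapes that do not depend on `τ`: `(0,0)`, `(0,±d₀)`, `(±d₀,±d₀)` (from `…HalfPlanarKey`). -/
theorem mp_key_const :
    (1 : ℝ) / 2 - 0 ≤ 1 * 1 * Real.cos (π / 3) ∧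
      (1 : ℝ) / 2 - 0 ≤ 1 * Real.sqrt (1 / 3) * Real.cos (π / 6) ∧
      (1 : ℝ) / 2 - 2 / 3 ≤ Real.sqrt (1 / 3) * Real.sqrt (1 / 3) * Real.cos (2 * π / 3) :=
  ⟨hp_key_00, hp_key_0b, hp_key_cc⟩

/-- A radius bound: `√(1 − (2/3)x²) ≥ 0.8449` for `0 ≤ x ≤ 0.655`. -/
theorem mp_radius_ge {x : ℝ} (h0 : 0 ≤ x) (h1 : x ≤ 0.655) :
    (0.8449 : ℝ) ≤ Real.sqrt (1 - (x * Real.sqrt (2 / 3)) ^ 2) := by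
  rw [mul_pow, hp_sqrt23_sq]
  apply Real.le_sqrt_of_sq_le
  nlinarith

/-- KEY `(0, τd₀)`-type: `1 · r · cos 0.93 ≥ ½` for `r = √(1 − (2/3)x²)`, `0 ≤ x ≤ 0.655`. -/
theorem mp_key_0a {x : ℝ} (h0 : 0 ≤ x) (h1 : x ≤ 0.655) :
    (1 : ℝ) / 2 - 0 ≤ 1 * Real.sqrt (1 - (x * Real.sqrt (2 / 3)) ^ 2) * Real.cos 0.93 := by
  have hr := mp_radius_ge h0 h1
  have hc := mp_cos_093
  nlinarith [mul_le_mul hr hc (by norm_num) (Real.sqrt_nonneg _)]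

/-- KEY `(τd₀, τd₀)`-type: `r² cos 1.09 ≥ ½ − h²`, `h = x d₀`, `0.345² ≤ x² ≤ 0.655²` (so `x = τ` or `τ − 1`). -/
theorem mp_key_aa {x : ℝ} (h0 : 0.119025 ≤ x ^ 2) (h1 : x ^ 2 ≤ 0.429025) :
    (1 : ℝ) / 2 - x * Real.sqrt (2 / 3) * (x * Real.sqrt (2 / 3)) ≤
      Real.sqrt (1 - (x * Real.sqrt (2 / 3)) ^ 2) * Real.sqrt (1 - (x * Real.sqrt (2 / 3)) ^ 2) *
        Real.cos 1.09 := by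
  have hs := hp_sqrt23_sq
  have hx2 : (x * Real.sqrt (2 / 3)) ^ 2 = 2 / 3 * x ^ 2 := by rw [mul_pow, hs]; ring
  have hnn : 0 ≤ 1 - (x * Real.sqrt (2 / 3)) ^ 2 := by rw [hx2]; nlinarith
  rw [Real.mul_self_sqrt hnn, hx2]
  have hc := mp_cos_109
  have hc1 := Real.cos_le_one (1.09 : ℝ)
  have hprod : x * Real.sqrt (2 / 3) * (x * Real.sqrt (2 / 3)) = 2 / 3 * x ^ 2 := by nlinarith [hs]
  rw [hprod]
  nlinarith [mul_le_mul_of_nonneg_left hc (show (0:ℝ) ≤ x ^ 2 by positivity)]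

/-- KEY `(τd₀, (τ−1)d₀)`: `r₁ r₂ cos 0.635 ≥ ½ − h₁ h₂` for `0.345 ≤ τ ≤ 0.655`. -/
theorem mp_key_ab {τ : ℝ} (h0 : 0.345 ≤ τ) (h1 : τ ≤ 0.655) :
    (1 : ℝ) / 2 - τ * Real.sqrt (2 / 3) * ((τ - 1) * Real.sqrt (2 / 3)) ≤
      Real.sqrt (1 - (τ * Real.sqrt (2 / 3)) ^ 2) * Real.sqrt (1 - ((τ - 1) * Real.sqrt (2 / 3)) ^ 2) *
        Real.cos 0.635 := by
  have hs := hp_sqrt23_sq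
  have hx2 : (τ * Real.sqrt (2 / 3)) ^ 2 = 2 / 3 * τ ^ 2 := by rw [mul_pow, hs]; ring
  have hy2 : ((τ - 1) * Real.sqrt (2 / 3)) ^ 2 = 2 / 3 * (τ - 1) ^ 2 := by rw [mul_pow, hs]; ring
  have hprod : τ * Real.sqrt (2 / 3) * ((τ - 1) * Real.sqrt (2 / 3)) = 2 / 3 * (τ * (τ - 1)) := by
    nlinarith [hs]
  rw [hx2, hy2, hprod]
  have hP0 : 0 ≤ 1 - 2 / 3 * τ ^ 2 := by nlinarith
  have hQ0 : 0 ≤ 1 - 2 / 3 * (τ - 1) ^ 2 := by nlinarith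
  rw [← Real.sqrt_mul hP0]
  set P : ℝ := (1 - 2 / 3 * τ ^ 2) * (1 - 2 / 3 * (τ - 1) ^ 2) with hPdef
  have hc := mp_cos_0635
  have hc0 : 0 ≤ Real.cos 0.635 := by linarith
  -- compare squares
  have hR : 0 ≤ 1 / 2 - 2 / 3 * (τ * (τ - 1)) := by nlinarith
  have hsq : (1 / 2 - 2 / 3 * (τ * (τ - 1))) ^ 2 ≤ P * Real.cos 0.635 ^ 2 := by
    have hc2 : (0.8042 : ℝ) ^ 2 ≤ Real.cos 0.635 ^ 2 := pow_le_pow_left₀ (by norm_num) hc 2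
    have hP1 : 0 ≤ P := mul_nonneg hP0 hQ0
    have hmain : (1 / 2 - 2 / 3 * (τ * (τ - 1))) ^ 2 ≤ P * (0.8042 : ℝ) ^ 2 := by
      rw [hPdef]; nlinarith [mul_nonneg (sub_nonneg.2 h0) (sub_nonneg.2 h1)]
    nlinarith [mul_le_mul_of_nonneg_left hc2 hP1]
  have hS : Real.sqrt P * Real.cos 0.635 = Real.sqrt (P * Real.cos 0.635 ^ 2) := by
    rw [Real.sqrt_mul' _ (sq_nonneg _), Real.sqrt_sq hc0]
  rw [hS]
  exact Real.le_sqrt_of_sq_le hsq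

/-- KEY `(τd₀, d₀)`-type: `r₁ · √(1/3) · cos 1.055 ≥ ½ − (2/3)x`, `0.345 ≤ x ≤ 0.655`. -/
theorem mp_key_ac {x : ℝ} (h0 : 0.345 ≤ x) (h1 : x ≤ 0.655) :
    (1 : ℝ) / 2 - x * Real.sqrt (2 / 3) * Real.sqrt (2 / 3) ≤
      Real.sqrt (1 - (x * Real.sqrt (2 / 3)) ^ 2) * Real.sqrt (1 / 3) * Real.cos 1.055 := by
  have hs := hp_sqrt23_sq
  have hx2 : (x * Real.sqrt (2 / 3)) ^ 2 = 2 / 3 * x ^ 2 := by rw [mul_pow, hs]; ring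
  have hprod : x * Real.sqrt (2 / 3) * Real.sqrt (2 / 3) = 2 / 3 * x := by nlinarith [hs]
  rw [hx2, hprod]
  have hP0 : 0 ≤ 1 - 2 / 3 * x ^ 2 := by nlinarith
  rw [← Real.sqrt_mul hP0]
  have hc := mp_cos_1055
  have hc0 : 0 ≤ Real.cos 1.055 := by linarith
  have hR : 0 ≤ 1 / 2 - 2 / 3 * x := by nlinarith
  have hsq : (1 / 2 - 2 / 3 * x) ^ 2 ≤ (1 - 2 / 3 * x ^ 2) * (1 / 3) * Real.cos 1.055 ^ 2 := by
    have hc2 : (0.4929 : ℝ) ^ 2 ≤ Real.cos 1.055 ^ 2 := pow_le_pow_left₀ (by norm_num) hc 2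
    have hP1 : 0 ≤ (1 - 2 / 3 * x ^ 2) * (1 / 3) := by nlinarith
    have hmain : (1 / 2 - 2 / 3 * x) ^ 2 ≤ (1 - 2 / 3 * x ^ 2) * (1 / 3) * (0.4929 : ℝ) ^ 2 := by
      nlinarith [mul_nonneg (sub_nonneg.2 h0) (sub_nonneg.2 h1)]
    nlinarith [mul_le_mul_of_nonneg_left hc2 hP1]
  have hS : Real.sqrt ((1 - 2 / 3 * x ^ 2) * (1 / 3)) * Real.cos 1.055 =
      Real.sqrt ((1 - 2 / 3 * x ^ 2) * (1 / 3) * Real.cos 1.055 ^ 2) := by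
    rw [Real.sqrt_mul' _ (sq_nonneg _), Real.sqrt_sq hc0]
  rw [hS]
  exact Real.le_sqrt_of_sq_le hsq

/-! ## Radii values and the 25-case dispatcher -/

/-- `r₀ = 1`. -/
theorem mpR_zero (τ : ℝ) : mpR τ 0 = 1 := by simp [mpR]

/-- `r₁(τ)`. -/
theorem mpR_one (τ : ℝ) : mpR τ 1 = Real.sqrt (1 - (τ * Real.sqrt (2 / 3)) ^ 2) := rfl

/-- `r₂(τ)`. -/
theorem mpR_two (τ : ℝ) : mpR τ 2 = Real.sqrt (1 - ((τ - 1) * Real.sqrt (2 / 3)) ^ 2) := rfl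

/-- `r₃ = √(1/3)`. -/
theorem mpR_three (τ : ℝ) : mpR τ 3 = Real.sqrt (1 / 3) := by
  rw [mpR, mpH_3]; congr 1; rw [hp_sqrt23_sq]; norm_num

/-- `r₄ = √(1/3)`. -/
theorem mpR_four (τ : ℝ) : mpR τ 4 = Real.sqrt (1 / 3) := by
  rw [mpR, mpH_4]; congr 1; rw [neg_pow, hp_sqrt23_sq]; norm_num

/-- **KEY on the interval**: for `τ ∈ [0.345, 0.655]` and every species pair, either no separation is claimed
(`δ = 0`) or `r_s(τ) · r_t(τ) · cos δ(s,t) ≥ ½ − h_s(τ) · h_t(τ)` with `0 < δ ≤ π`. -/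
theorem mp_key {τ : ℝ} (hτ0 : 0.345 ≤ τ) (hτ1 : τ ≤ 0.655) (s t : ℕ) (hs : s < 5) (ht : t < 5) :
    mpDelta s t = 0 ∨
      (1 / 2 - mpH τ s * mpH τ t ≤ mpR τ s * mpR τ t * Real.cos (mpDelta s t) ∧
        0 < mpDelta s t ∧ mpDelta s t ≤ π) := by
  have hπ1 := Real.pi_gt_d6
  have hπ2 := Real.pi_lt_d6
  have hπ0 : 0 < π := Real.pi_pos
  have hsq23 := hp_sqrt23_sq
  have hτ0' : (0 : ℝ) ≤ τ := by linarith
  have h1τ0 : (0 : ℝ) ≤ 1 - τ := by linarith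
  have h1τ0' : (0.345 : ℝ) ≤ 1 - τ := by linarith
  have h1τ1 : 1 - τ ≤ (0.655 : ℝ) := by linarith
  have hx2lo : (0.119025 : ℝ) ≤ τ ^ 2 := by nlinarith
  have hx2hi : τ ^ 2 ≤ (0.429025 : ℝ) := by nlinarith
  have hy2lo : (0.119025 : ℝ) ≤ (τ - 1) ^ 2 := by nlinarith
  have hy2hi : (τ - 1) ^ 2 ≤ (0.429025 : ℝ) := by nlinarith
  -- radius of species 2 rewritten with `1 - τ ≥ 0`
  have hR2 : Real.sqrt (1 - ((τ - 1) * Real.sqrt (2 / 3)) ^ 2) =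
      Real.sqrt (1 - ((1 - τ) * Real.sqrt (2 / 3)) ^ 2) := by ring_nf
  interval_cases s <;> interval_cases t
  · right; rw [show mpDelta 0 0 = π / 3 by norm_num [mpDelta], mpH_0, mpR_zero, mul_zero]
    exact ⟨hp_key_00, by positivity, by linarith⟩
  · right; rw [show mpDelta 0 1 = 0.93 by norm_num [mpDelta], mpH_0, mpR_zero, mpR_one, zero_mul]
    exact ⟨mp_key_0a hτ0' hτ1, by norm_num, by linarith⟩
  · right; rw [show mpDelta 0 2 = 0.93 by norm_num [mpDelta], mpH_0, mpR_zero, mpR_two, zero_mul, hR2]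
    exact ⟨mp_key_0a h1τ0 h1τ1, by norm_num, by linarith⟩
  · right; rw [show mpDelta 0 3 = π / 6 by norm_num [mpDelta], mpH_0, mpR_zero, mpR_three, zero_mul]
    exact ⟨hp_key_0b, by positivity, by linarith⟩
  · right; rw [show mpDelta 0 4 = π / 6 by norm_num [mpDelta], mpH_0, mpR_zero, mpR_four, zero_mul]
    exact ⟨hp_key_0b, by positivity, by linarith⟩
  · right; rw [show mpDelta 1 0 = 0.93 by norm_num [mpDelta], mpH_0, mpR_zero, mpR_one, mul_zero]
    refine ⟨?_, by norm_num, by linarith⟩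
    have := mp_key_0a hτ0' hτ1; linarith
  · right; rw [show mpDelta 1 1 = 1.09 by norm_num [mpDelta], mpH_1, mpR_one]
    exact ⟨mp_key_aa hx2lo hx2hi, by norm_num, by linarith⟩
  · right; rw [show mpDelta 1 2 = 0.635 by norm_num [mpDelta], mpH_1, mpH_2, mpR_one, mpR_two]
    exact ⟨mp_key_ab hτ0 hτ1, by norm_num, by linarith⟩
  · right; rw [show mpDelta 1 3 = 1.055 by norm_num [mpDelta], mpH_1, mpH_3, mpR_one, mpR_three]
    exact ⟨mp_key_ac hτ0 hτ1, by norm_num, by linarith⟩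
  · left; norm_num [mpDelta]
  · right; rw [show mpDelta 2 0 = 0.93 by norm_num [mpDelta], mpH_0, mpR_zero, mpR_two, mul_zero, hR2]
    refine ⟨?_, by norm_num, by linarith⟩
    have := mp_key_0a h1τ0 h1τ1; linarith
  · right; rw [show mpDelta 2 1 = 0.635 by norm_num [mpDelta], mpH_1, mpH_2, mpR_one, mpR_two]
    refine ⟨?_, by norm_num, by linarith⟩
    have := mp_key_ab hτ0 hτ1; linarith
  · right; rw [show mpDelta 2 2 = 1.09 by norm_num [mpDelta], mpH_2, mpR_two]
    exact ⟨mp_key_aa hy2lo hy2hi, by norm_num, by linarith⟩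
  · left; norm_num [mpDelta]
  · right; rw [show mpDelta 2 4 = 1.055 by norm_num [mpDelta], mpH_2, mpH_4, mpR_two, mpR_four, hR2]
    refine ⟨?_, by norm_num, by linarith⟩
    have h := mp_key_ac h1τ0' h1τ1
    have e : (τ - 1) * Real.sqrt (2 / 3) * -Real.sqrt (2 / 3) = (1 - τ) * Real.sqrt (2 / 3) * Real.sqrt (2 / 3) := by
      ring
    rw [e]; exact h
  · right; rw [show mpDelta 3 0 = π / 6 by norm_num [mpDelta], mpH_0, mpR_zero, mpR_three, mul_zero]
    exact ⟨hp_key_b0, by positivity, by linarith⟩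
  · right; rw [show mpDelta 3 1 = 1.055 by norm_num [mpDelta], mpH_1, mpH_3, mpR_one, mpR_three]
    refine ⟨?_, by norm_num, by linarith⟩
    have h := mp_key_ac hτ0 hτ1
    rw [mul_comm (Real.sqrt (2 / 3)) (τ * Real.sqrt (2 / 3)), mul_comm (Real.sqrt (1 / 3))]; exact h
  · left; norm_num [mpDelta]
  · right; rw [show mpDelta 3 3 = 2 * π / 3 by norm_num [mpDelta], mpH_3, mpR_three, hpB_sq]
    exact ⟨hp_key_cc, by positivity, by linarith⟩
  · left; norm_num [mpDelta]
  · right; rw [show mpDelta 4 0 = π / 6 by norm_num [mpDelta], mpH_0, mpR_zero, mpR_four, mul_zero]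
    exact ⟨hp_key_b0, by positivity, by linarith⟩
  · left; norm_num [mpDelta]
  · right; rw [show mpDelta 4 2 = 1.055 by norm_num [mpDelta], mpH_2, mpH_4, mpR_two, mpR_four, hR2]
    refine ⟨?_, by norm_num, by linarith⟩
    have h := mp_key_ac h1τ0' h1τ1
    have e : -Real.sqrt (2 / 3) * ((τ - 1) * Real.sqrt (2 / 3)) = (1 - τ) * Real.sqrt (2 / 3) * Real.sqrt (2 / 3) := by
      ring
    rw [e, mul_comm (Real.sqrt (1 / 3))]; exact h
  · left; norm_num [mpDelta]
  · right; rw [show mpDelta 4 4 = 2 * π / 3 by norm_num [mpDelta], mpH_4, mpR_four, neg_mul_neg, hpB_sq]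
    exact ⟨hp_key_cc, by positivity, by linarith⟩

/-- The integer table under-estimates `10⁴ · δ`. -/
theorem mp_tbl (s t : ℕ) (hs : s < 5) (ht : t < 5) :
    ((azGet mpTbl s t : ℤ) : ℝ) ≤ 10000 * mpDelta s t := by
  have hπ1 := Real.pi_gt_d6
  interval_cases s <;> interval_cases t <;> norm_num [mpDelta, mpTbl, azGet] <;> nlinarith [hπ1]


end Summit.Ventures.Crystal3D.Theorems

end
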